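import Summits.BirchSwinnertonDyer.Rank1Residual.GaloisImage.KolyvaginSystemsKummerVanishRat
import Summits.BirchSwinnertonDyer.Rank1Residual.GaloisImage.CanonicalKolyvaginDatumAdmissible
import HarnessLib

/-!
# `KS₁(E[p], 𝓚, 𝒫(τ)) = 0` over `ℚ` for the CANONICAL Kolyvagin datum: R1-16 FILE 6 with the
# admissibility binder `hadm` DISCHARGED
# (cell `b2b-bsdres`, team n1011, ROUTE-1 item R1-16 × row T-HCC-adm; seat p11 gen 4; file 5/5;
# skeletons `cells/n1011/skel/T-R1-16.md`, `cells/n1011/skel/T-HCC-adm.md`)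

HONEST FRAMING (verbatim for the cell): research route; prove what is provable now; shrink each hard
class to its core with data; no claim beyond stated classes; nothing booked; no mark / label moved.
ONE theorem, no definition, no named fact, no conjecture node.

p265113 (`CoreRankZero.kummer_kolyvaginSystems_eq_bot_rat`, R1-16 FILE 6) proves: for `E/ℚ`, an odd
prime `p`, the classical `p`-descent Selmer structure `𝓚`, and a Kolyvagin datum `D` on `E[p]` with
`D.primes = frobeniusClassPrimes ρ {v | v ∈ S} τ p` (`τ ∈ Γ_{ℚ(μ_p)}`, `E[p]/(τ−1)E[p] ≅ ℤ/p`) and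
cyclotomic transverse conditions, `KS₁(E[p], 𝓚, 𝒫(τ)) = 0` — with, among its binders, the
ADMISSIBILITY `hadm : D.IsAdmissible` of the comparison maps.  Row T-HCC-adm (files
`FiniteSingularComparison{Field,Operator,Injective}`, `CanonicalKolyvaginDatumAdmissible`) proves
[MR04] Lemma 1.2.3 / Rubin PCMI Ex. 1.9.7 in the kernel: a datum whose comparison maps are THE
CANONICAL ones (`D.HasCanonicalComparison p η`, Kim's primitive roots `η`; n1011-lit's predicate,
n1011-p04's construction) IS admissible at Sakamoto's primes.  Hence this file's single theorem:
the same vanishing for every CANONICAL datum, `hadm` replaced by `hD : D.HasCanonicalComparison p η`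
— a hypothesis DISCHARGED BY CONSTRUCTION (n1011-p04
`FSComp.exists_kolyvaginDatum_hasCanonicalComparison_frobeniusClassPrimes`: such `D` exist for every
choice of primitive roots).  The `𝔽_p`-structure of `E[p]` enters as instance arguments (as in the
predicate itself; the unique one, `AddCommGroup.zmodModule` — registered globally at `p = 3` by
n1011-p13's `SakamotoN11InstanceResidual`).

Binders left (all named, none minted here): the Poitou–Tate family (`IsPerfect`,
`SumLocalTermEqZero`, `SelmerComplement` — the cited fact `poitouTate_selmerStructure_duality`),
Tate's local Euler characteristic `hEP` (cited fact `localEulerPoincareCharacteristic`), the finite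
set `S` (`hS`, `h𝓚`), and the prime choice `hC55` ([S24] Cor. 5.5 shape; row T-C55K, n1011-p15, in
progress — the tree's proved Chebotarev).

References: [MazurRubin2004] Lemma 1.2.3, Thm. 4.2.2; [Rubin2011] Prop. 1.4.13, 1.9.5, Ex. 1.9.7,
Thm. 2.7.6; [Sakamoto2024] §2, §4, Cor. 5.5; [SilvermanAEC2009] Thm. X.4.2 (b).
-/

noncomputable section

open scoped Classical NumberField ContRepresentation
open Function Field NumberField IsDedekindDomain WeierstrassCurve
open Literature.NumberTheory.EllipticCurves
open Literature.NumberTheory.GaloisRepresentations Literature.NumberTheory.GaloisRepresentations.DiscreteGaloisModule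
  Literature.NumberTheory.GaloisCohomology

namespace Summit.BirchSwinnertonDyer.Rank1Residual.GaloisImage.CoreRankZero

/-- **`KS₁(E[p], 𝓚, 𝒫(τ)) = 0` over `ℚ` for every CANONICAL Kolyvagin datum** — R1-16 FILE 6
(`kummer_kolyvaginSystems_eq_bot_rat`, Rubin PCMI Thm. 2.7.6 at `m = 1` / [MR04] Thm. 4.2.2 for the
core-rank-zero structure `𝓚`) with the admissibility binder DISCHARGED by row T-HCC-adm
(`FSComp.isAdmissible_of_hasCanonicalComparison_frobeniusClassPrimes`, [MR04] Lemma 1.2.3):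
`E/ℚ` elliptic, `p` an odd prime, `E[p]` with its `𝔽_p`-structure (instance arguments), `D` a
Kolyvagin datum on `E[p]` with `D.primes = frobeniusClassPrimes ρ {v | v ∈ S} τ p`
(`τ ∈ Γ_{ℚ(μ_p)}`, `E[p]/(τ−1)E[p] ≅ ℤ/p`), `D.transverse = cyclotomicTransverse ρ` and
`D.HasCanonicalComparison p η` (THE canonical comparison maps for Kim's primitive roots `η`; such
data exist, n1011-p04): every Kolyvagin system for `(E[p], 𝓚, 𝒫(τ))` vanishes.  Binders kept
(named): Poitou–Tate family, `hEP`, `hS`/`h𝓚`, `hC55`.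
[cite: Rubin2011, Thm. 2.7.6 (p. 24) and Exercise 1.9.7 (p. 15)] [cite: MazurRubin2004, Lemma 1.2.3 (p. 10–11)]
[cite: Sakamoto2024, §2 (p. 921), §4 (p. 925) and Cor. 5.5 (p. 929)] -/
theorem kummer_kolyvaginSystems_eq_bot_rat_of_hasCanonicalComparison (W : WeierstrassCurve ℚ)
    [W.IsElliptic] (p : ℕ) [Fact p.Prime] (hp2 : p ≠ 2)
    [Module (ZMod p) (geomTorsion W (p : ℤ))] [Module.Free (ZMod p) (geomTorsion W (p : ℤ))]
    [Module.Finite (ZMod p) (geomTorsion W (p : ℤ))]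
    {inv : LocalInvariants ℚ p}
    (hperf : inv.IsPerfect) (hsum : inv.SumLocalTermEqZero) (hcompl : inv.SelmerComplement)
    (hEP : ∀ v : HeightOneSpectrum (𝓞 ℚ), localEulerPoincareCharacteristic (v.adicCompletion ℚ))
    {S : Finset (Place ℚ)}
    (hS : ∀ v : HeightOneSpectrum (𝓞 ℚ), (Sum.inr v : Place ℚ) ∉ S →
      ((p : ℕ) : 𝓞 ℚ) ∉ v.asIdeal ∧ GaloisRep.IsUnramifiedAt v (W.torsionGaloisModule (p : ℤ)))
    (h𝓚 : (W.kummerSelmerStructure (p : ℤ)).IsUnramifiedOutside S)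
    {D : KolyvaginDatum (W.torsionGaloisModule (p : ℤ))} {τ : absoluteGaloisGroup ℚ}
    (hP : D.primes = frobeniusClassPrimes (W.torsionGaloisModule (p : ℤ))
      {v | (Sum.inr v : Place ℚ) ∈ S} τ p)
    (hT : D.transverse = cyclotomicTransverse (W.torsionGaloisModule (p : ℤ)))
    (hτ : Nonempty (cokerSubOne (W.torsionGaloisModule (p : ℤ)) τ ≃+ ZMod p))
    (hτμ : τ ∈ rootsOfUnityFixer ℚ p)
    {η : (q : HeightOneSpectrum (𝓞 ℚ)) → (ZMod (Ideal.absNorm q.asIdeal))ˣ}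
    (hD : D.HasCanonicalComparison p η)
    (hC55 : ∀ c₁ c₂ c₃ : galoisCohomology (W.torsionGaloisModule (p : ℤ)) 1, c₁ ≠ 0 → c₂ ≠ 0 →
      c₃ ≠ 0 →
      {q ∈ D.primes |
        galoisCohomology.localization (W.torsionGaloisModule (p : ℤ)) (Sum.inr q) 1 c₁ ≠ 0 ∧
        galoisCohomology.localization (W.torsionGaloisModule (p : ℤ)) (Sum.inr q) 1 c₂ ≠ 0 ∧
        galoisCohomology.localization (W.torsionGaloisModule (p : ℤ)) (Sum.inr q) 1 c₃ ≠ 0}.Infinite) :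
    D.kolyvaginSystems (W.kummerSelmerStructure (p : ℤ)) = ⊥ :=
  haveI : Finite (geomTorsion W (p : ℤ)) := Module.finite_of_finite (ZMod p)
  kummer_kolyvaginSystems_eq_bot_rat W p hp2 hperf hsum hcompl hEP hS h𝓚 hP hT hτ hτμ
    (FSComp.isAdmissible_of_hasCanonicalComparison_frobeniusClassPrimes (W.torsionGaloisModule (p : ℤ))
      p {v | (Sum.inr v : Place ℚ) ∈ S} hτ hτμ hP hD) hC55

end Summit.BirchSwinnertonDyer.Rank1Residual.GaloisImage.CoreRankZero

end
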